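/-
Origin: expansion seat `planner-pub-hodgecm-pv07-0`, handover 2026-08-18 (`HOME/pub-hodgecm-pv07/lean/Pv07/PiecesRamPos.lean`, md5 d748f9c0, 152 lines);
landed by the gen-6 packager in gate run 22 as `HodgeCM/PerL34/LocalFactors/PiecesRamPos.lean` (verbatim).
-/
/-
Copyright: HodgeCM publication cell (pub-hodgecm), DAG node N31f (prover pv07).
Released under the package licence.

# N31f → `LocalFactorPieces.ram_pos` BY NAME at the compact places (tex ll. 612–617)

The carver's SEAM TABLE (LEMMAS.md §9, S3) locates the N31f content consumed downstream as the field
`EulerFactorisation.LocalFactorPieces.ram_pos : ∀ v ∈ S, 0 < (loc v).I` of pv13's S3 constructor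
(`HodgeCM.PerL34.LocalFactorPieces`, gate run 21), where `loc v : LocalIntegrand` is the local matrix-coefficient
integrand `f_v(y) = ⟪φ_v, ω_v(y) φ_v⟫ χ'_v(y)` and `(loc v).I = Re ∫ f_v`.

This file discharges that field ON pv13's OWN STRUCTURE, with no further dictionary, at every place of `S` where
the chosen local vector is isotypic — i.e. at the archimedean places and the non-split finite places (tex
ll. 612–617: "`U(W_i)(L_{0,v})` compact … `I_v(φ_v) = vol · ‖φ_v[χ̄'_v]‖²`, non-zero for suitable `φ_v`";
the chosen `φ_v` IS its own `χ̄'_v`-component, by L4.1(a) at real places (N27) and by local occurrence at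
non-split finite places (N31a)):

* `loc_f_eq_const_of_isotypic` : if `ω(y) φ = conj (χ y) • φ` for all `y` and `|χ| = 1`, then
  `f(y) = ‖φ‖²` identically;
* `loc_Ic_eq_of_isotypic`, `loc_I_eq_of_isotypic` : `I = μ(G) · ‖φ‖²` for a finite measure
  (`U(W_i)(L_{0,v})` compact, Haar measure finite — the "vol" of l. 614);
* `loc_I_pos_of_isotypic` : `0 < I` as soon as `μ(G) ≠ 0` and `φ ≠ 0`;
* `ram_pos_of_isotypic` : the field shape `∀ v ∈ S, 0 < (loc v).I` from these hypotheses place by place.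

What stays an input: at the SPLIT places of `S` the chosen vector is `1_D` (not isotypic) and `0 < I_v` is the ball
computation `N31f_core_split_holds` (`HodgeCM.PerL34.LocalFactors.SplitFactor`), which reaches `(loc v).I` only
through the `L²(L_{0,v}³)` dilation model of `ω_v|U(W_i)` (print, D4; GAPS pv07-G1).  `ram_pos_of_models'` below
therefore takes, per `v ∈ S`, EITHER the isotypic hypotheses OR a real number known to be `(loc v).I` and positive.

The last section identifies the two shells BY NAME: pv13's `LocalIntegrand.Ic` IS pv07's
`LocalFactors.localFactor μ ρ χ φ` for `ρ := locToRep L` (the isometries as continuous linear maps) whenever pv13's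
bare character function is a homomorphism (`loc_Ic_eq_localFactor`), and the two isotypy predicates agree
(`locIsIsotypic_iff`) — so the compact-place core `N31f_core_compact_holds` (projection formula, `I_v ≥ 0`) applies to
`loc v` literally.  Nothing cited, nothing asserted.
-/
import Summits.HodgeConjecture.HodgeCM.PerL34.LocalFactorPieces
import Summits.HodgeConjecture.HodgeCM.PerL34.LocalFactors.CompactFactor

noncomputable section

open MeasureTheory Complex ComplexConjugate
open scoped InnerProductSpace

namespace HodgeCM
namespace PerL34
namespace LocalFactors

open EulerFactorisation

/-! All declarations below live in pv07's namespace `HodgeCM.PerL34.LocalFactors` and take pv13's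
`EulerFactorisation.LocalIntegrand` as an explicit argument (no names are added to pv13's namespaces). -/

variable (L : LocalIntegrand)

/-- `χ̄`-isotypy of the chosen vector: `ω(y) φ = conj (χ y) • φ` ("`U(W_{i,b})` acts there by `χ̄'_b(u)`",
tex l. 616). -/
def locIsIsotypic : Prop := ∀ y : L.G, L.ω y L.φ = conj (L.χ y) • L.φ

/-- For an isotypic vector and a unitary character the integrand is the constant `‖φ‖²` (l. 614–616:
`⟨ω(y)φ,φ⟩χ'(y) = χ̄'(y)χ'(y)‖φ‖² = ‖φ‖²`). -/
theorem loc_f_eq_const_of_isotypic (hiso : locIsIsotypic L) (hχ : ∀ y, ‖L.χ y‖ = 1) (y : L.G) :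
    L.f y = ((‖L.φ‖ ^ 2 : ℝ) : ℂ) := by
  unfold LocalIntegrand.f
  rw [hiso y, inner_smul_right, mul_right_comm, mul_comm (conj (L.χ y)), Complex.mul_conj,
    Complex.normSq_eq_norm_sq, hχ y, inner_self_eq_norm_sq_to_K]
  norm_num

/-- `I_v = vol(U(W_i)(L_{0,v})) · ‖φ_v‖²` as a complex number (l. 614), for a finite (Haar) measure. -/
theorem loc_Ic_eq_of_isotypic [IsFiniteMeasure L.μ] (hiso : locIsIsotypic L) (hχ : ∀ y, ‖L.χ y‖ = 1) :
    L.Ic = ((L.μ.real Set.univ * ‖L.φ‖ ^ 2 : ℝ) : ℂ) := by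
  unfold LocalIntegrand.Ic
  rw [show L.f = fun _ => ((‖L.φ‖ ^ 2 : ℝ) : ℂ) from funext (loc_f_eq_const_of_isotypic L hiso hχ),
    integral_const, Complex.real_smul]
  push_cast
  ring

/-- … and as the real number `I_v`. -/
theorem loc_I_eq_of_isotypic [IsFiniteMeasure L.μ] (hiso : locIsIsotypic L) (hχ : ∀ y, ‖L.χ y‖ = 1) :
    L.I = L.μ.real Set.univ * ‖L.φ‖ ^ 2 := by
  unfold LocalIntegrand.I
  rw [loc_Ic_eq_of_isotypic L hiso hχ, Complex.ofReal_re]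

/-- **N31f at a compact place, by name on pv13's structure**: `0 < I_v` for a nonzero isotypic `φ_v`, a unitary
`χ'_v` and a finite measure of nonzero total mass (Haar measure of the compact group `U(W_i)(L_{0,v})`). -/
theorem loc_I_pos_of_isotypic [IsFiniteMeasure L.μ] (hμ : L.μ Set.univ ≠ 0) (hiso : locIsIsotypic L)
    (hχ : ∀ y, ‖L.χ y‖ = 1) (hφ : L.φ ≠ 0) : 0 < L.I := by
  rw [loc_I_eq_of_isotypic L hiso hχ]
  exact mul_pos (ENNReal.toReal_pos hμ (measure_ne_top _ _)) (pow_pos (norm_pos_iff.mpr hφ) 2)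

/-! ### The two shells agree by name (pv13 `LocalIntegrand` ↔ pv07 `LocalFactors`) -/

/-- The unitary operators `ω_v(y)` as continuous linear maps: a representation in pv07's format. -/
def locToRep : L.G →* (L.Sp →L[ℂ] L.Sp) where
  toFun y := ((L.ω y).toContinuousLinearEquiv : L.Sp →L[ℂ] L.Sp)
  map_one' := by
    ext v
    simp
  map_mul' y z := by
    ext v
    simp

/-- (Ported verbatim from the HodgeCMPerL package; no docstring in the source.) -/
@[simp] theorem locToRep_apply (y : L.G) (v : L.Sp) : locToRep L y v = L.ω y v := rfl

/-- pv13's local factor IS pv07's `localFactor` (same integrand up to the order of the two factors), for a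
character that is a homomorphism. -/
theorem loc_Ic_eq_localFactor (χh : L.G →* ℂ) (hχ : ∀ y, χh y = L.χ y) :
    L.Ic = localFactor L.μ (locToRep L) χh L.φ := by
  unfold LocalIntegrand.Ic LocalIntegrand.f LocalFactors.localFactor
  congr 1
  funext y
  rw [hχ, locToRep_apply, mul_comm]

/-- The two isotypy predicates agree. -/
theorem locIsIsotypic_iff (χh : L.G →* ℂ) (hχ : ∀ y, χh y = L.χ y) :
    locIsIsotypic L ↔ IsIsotypic (locToRep L) χh L.φ := by
  simp only [locIsIsotypic, IsIsotypic, locToRep_apply, hχ]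

/-- Hence pv07's compact-place positivity applies verbatim to pv13's integrand (Haar probability normalisation). -/
theorem loc_I_pos_of_isotypic' [IsProbabilityMeasure L.μ] (χh : L.G →* ℂ) (hχ : ∀ y, χh y = L.χ y)
    (hχ1 : ∀ y, ‖L.χ y‖ = 1) (hiso : locIsIsotypic L) (hφ : L.φ ≠ 0) : 0 < L.I := by
  unfold LocalIntegrand.I
  rw [loc_Ic_eq_localFactor L χh hχ]
  exact localFactor_pos_of_isotypic (fun g => (hχ g).symm ▸ hχ1 g)
    ((locIsIsotypic_iff L χh hχ).mp hiso) hφ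

/-- **The field shape `LocalFactorPieces.ram_pos`, compact places.**  If at every `v ∈ S` the local integrand has
finite measure of nonzero mass, unitary `χ'_v` and a nonzero isotypic chosen vector, then `∀ v ∈ S, 0 < (loc v).I`. -/
theorem ram_pos_of_isotypic {V : Type} (S : Finset V) (loc : V → LocalIntegrand)
    (hfin : ∀ v ∈ S, IsFiniteMeasure (loc v).μ) (hμ : ∀ v ∈ S, (loc v).μ Set.univ ≠ 0)
    (hiso : ∀ v ∈ S, locIsIsotypic (loc v)) (hχ : ∀ v ∈ S, ∀ y, ‖(loc v).χ y‖ = 1)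
    (hφ : ∀ v ∈ S, (loc v).φ ≠ 0) : ∀ v ∈ S, 0 < (loc v).I := fun v hv =>
  haveI := hfin v hv
  loc_I_pos_of_isotypic (loc v) (hμ v hv) (hiso v hv) (hχ v hv) (hφ v hv)

/-- **The field shape, all of `S`** (tex ll. 612–623): each `v ∈ S` is EITHER a compact place with an isotypic
nonzero chosen vector (discharged here) OR a split place where `(loc v).I` is identified with a positive ball factor
(`N31f_core_split_holds`, via the D4 model — supplied as the hypothesis `hsplit`). -/
theorem ram_pos_of_models' {V : Type} (S : Finset V) (loc : V → LocalIntegrand) (IsSplitPlace : V → Prop)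
    (hcpt : ∀ v ∈ S, ¬IsSplitPlace v →
      IsFiniteMeasure (loc v).μ ∧ (loc v).μ Set.univ ≠ 0 ∧ locIsIsotypic (loc v) ∧ (∀ y, ‖(loc v).χ y‖ = 1) ∧
        (loc v).φ ≠ 0)
    (hsplit : ∀ v ∈ S, IsSplitPlace v → 0 < (loc v).I) : ∀ v ∈ S, 0 < (loc v).I := by
  intro v hv
  by_cases hs : IsSplitPlace v
  · exact hsplit v hv hs
  · obtain ⟨hfin, hμ, hiso, hχ, hφ⟩ := hcpt v hv hs
    haveI := hfin
    exact loc_I_pos_of_isotypic (loc v) hμ hiso hχ hφ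

end LocalFactors
end PerL34
end HodgeCM
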